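import Summits.HubbardSuperconductivity.HubbardSuperconductivity.Theorems.AnisotropyChordTransferFibre3FinMHoleUpTo14
import Summits.HubbardSuperconductivity.HubbardSuperconductivity.Theorems.AnisotropyChordTransferFibre3FinMHoleFifteen
import Summits.HubbardSuperconductivity.HubbardSuperconductivity.Theorems.AnisotropyChordTransferFibre3FinMHoleSixteen

/-!
# Route `AnisotropyChord` / H0 rotor rung: ★ the regime clause `mHole ≥ 0` for every ground profile, `9 ≤ L ≤ 16` (FIN-class, kernel-certified)

`mHole_nonneg_of_le_16`: for `9 ≤ L ≤ 16`, every `0 < Δ < 1` and every ground two-magnon profile `f`, `0 ≤ mHole L Δ f` —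
`mHole_nonneg_of_le_14` (`…FinMHoleUpTo14`) extended by the row–column certificates `mHole_nonneg_fifteen`, `mHole_nonneg_sixteen`
(`…FinMHoleFifteen`, `…FinMHoleSixteen`, evaluator `…FinRCCell`).
Prover seat `hubbard-h0-rotor-p3` g4; helper for stmt-HubbardSuperconductivity-23918 (piece A of rung 19089; `--supports`, helper class).
WHAT THIS IS NOT: nothing here proves superconductivity in the Hubbard model (rotor TARGET as worded stays FALSE, g15 verdict); one
hypothesis of ONE conditional reduction on a finite range of `L`; the three β-free cruxes, the side condition and `17 ≤ L ≤ 30` remain.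
Tree imports only; no sorry.
-/

set_option linter.dupNamespace false
set_option autoImplicit false

namespace Summit.HubbardSuperconductivity.HubbardSuperconductivity.Theorems.AnisotropyChord.Transfer.Fibre3

/-- ★★ THE REGIME CLAUSE `mHole ≥ 0` FOR `9 ≤ L ≤ 16`: every ground two-magnon profile, `0 < Δ < 1`, has
`T⁺ ≤ ε₁(1 − 5/V + 6/V²)/2` (FIN-class, kernel-certified with zero data, uniform in `L` on the range). [folklore] -/
theorem mHole_nonneg_of_le_16 (L : ℕ) [NeZero L] (h9 : 9 ≤ L) (h16 : L ≤ 16) {Δ : ℝ} (hΔ0 : 0 < Δ) (hΔ1 : Δ < 1) :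
    ∀ lam2 : ℝ, ∀ f : Tor L → ℝ, IsGroundTwoMagnon L Δ lam2 f → 0 ≤ mHole L Δ f := by
  by_cases h14 : L ≤ 14
  · exact mHole_nonneg_of_le_14 L h9 h14 hΔ0 hΔ1
  · have h15 : 15 ≤ L := by omega
    clear h9 h14
    interval_cases L
    · exact mHole_nonneg_fifteen hΔ0 hΔ1
    · exact mHole_nonneg_sixteen hΔ0 hΔ1

end Summit.HubbardSuperconductivity.HubbardSuperconductivity.Theorems.AnisotropyChord.Transfer.Fibre3
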